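import Summits.AtomisticToContinuum.HydrodynamicLimit.Theses.TwoClocks
import Summits.AtomisticToContinuum.HydrodynamicLimit.Theses.OneFlightGossipEngine
import Summits.AtomisticToContinuum.HydrodynamicLimit.Theorems.ImplosionDichotomyHydroLimitInBandOfHeart
import Summits.AtomisticToContinuum.HydrodynamicLimit.Theorems.ImplosionDichotomyHydroLimitInBandSplit
import Summits.AtomisticToContinuum.HydrodynamicLimit.Theorems.TwoClocksTransferEntropyClockFamilyNodesReduction
import Summits.AtomisticToContinuum.HydrodynamicLimit.Theorems.OneFlightGossipEngineAssembly
import HarnessLib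

/-!
# `TwoClocks.TransferEntropyClock` from the three family-uniform nodes ALONE — the glue theorem of the foreseen split
# (line `Sketch`, crux stmt-AtomisticToContinuum-16625; support file)

Registered stub `stub_transferEntropyClockOfFamilyNodes` of the line, signature verbatim: the macroscopic clock of route TwoClocks,
`TransferEntropyClock = KineticWindowLDUniform → ClampedTransferWindowLD → TransferActivityTails → EnergyCurrentTails →
DiluteSelfConsistency → _root_.HydrodynamicLimit`, follows from EXACTLY the three family-uniform nodes
`HydroLimitInBandOfHeart.{KineticCurrentsWindowLDFamily, LocalClampedTransferWindowLDFamily, CoherentSuprathermalContentVanishesW}`: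
the shared one-window heart is now sorry-free in the tree (`HydroLimitInBandSplit.oneWindowLedger_holds`, crux 9133 lead c7, over the
landed clauses `stub_windowClause` / `stub_staticClause`), and the rest is the landed composition
`TransferEntropyClockFamilyNodes.transferEntropyClock_of_heart_of_familyNodes` (p135302: TA → CAT ∧ CEAT, ECT by name, landed window
continuity, `hydroLimitInBand_of_heart`, and `_root_.HydrodynamicLimit` = `ImplosionDichotomy.HydroLimitInBand` since D-0032).
`KineticWindowLDUniform`, `ClampedTransferWindowLD`, `DiluteSelfConsistency` are idle.

Also recorded: the same glue typed over the decl of the staffed board item stmt-16659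
(`OneFlightGossipEngine.KineticCurrentsLDAlongFamilies`, `Iff.rfl` with the heart's kinetic node by the landed
`kineticCurrentsLDAlongFamilies_iff_family`-style identification), so that a route-level split of crux 16625 can name the SAME three
children as the split of crux 9133 (`HydroLimitInBandSplit.HydroLimitInBand_of_subs`) minus the two tail items the clock already binds.
Lead prover-line-stmt-AtomisticToContinuum-16625-c2-0, cycle 2.
-/

namespace Summit.AtomisticToContinuum.HydrodynamicLimit.Theorems.TransferEntropyClockHeart

open Summit.AtomisticToContinuum.HydrodynamicLimit.Theses
open Summit.AtomisticToContinuum.HydrodynamicLimit.Theorems.HydroLimitInBandOfHeart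
  (LocalClampedTransferWindowLDFamily CoherentSuprathermalContentVanishesW KineticCurrentsWindowLDFamily)
open Summit.AtomisticToContinuum.HydrodynamicLimit.Theorems.TransferEntropyClockFamilyNodes
  (transferEntropyClock_of_heart_of_familyNodes assembly_of_heart_of_familyNodes)

/-- **The macroscopic clock of route TwoClocks from the three family-uniform nodes alone** (registered stub
`stub_transferEntropyClockOfFamilyNodes` of line `Sketch`, crux stmt-AtomisticToContinuum-16625, signature verbatim; the glue theorem
of the foreseen split of the crux): the sorry-free heart `HydroLimitInBandSplit.oneWindowLedger_holds` fed to the landed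
`transferEntropyClock_of_heart_of_familyNodes`. [cite: Yau1991, §2] -/
theorem stub_transferEntropyClockOfFamilyNodes : KineticCurrentsWindowLDFamily → LocalClampedTransferWindowLDFamily → CoherentSuprathermalContentVanishesW → TwoClocks.TransferEntropyClock :=
  transferEntropyClock_of_heart_of_familyNodes HydroLimitInBandSplit.oneWindowLedger_holds

/-- **The route's Assembly frame from the three family nodes** (stmt-AtomisticToContinuum-16626, a weakening of the clock).
[cite: Yau1991, §2] -/
theorem assembly_of_familyNodes (hK : KineticCurrentsWindowLDFamily) (hL : LocalClampedTransferWindowLDFamily)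
    (hC : CoherentSuprathermalContentVanishesW) : TwoClocks.Assembly :=
  assembly_of_heart_of_familyNodes HydroLimitInBandSplit.oneWindowLedger_holds hK hL hC

/-- **The same glue over the staffed kinetic item's decl** (`OneFlightGossipEngine.KineticCurrentsLDAlongFamilies`, stmt-16659, is
the heart's `KineticCurrentsWindowLDFamily` — same term): `TransferEntropyClock ⇐ KCWF, LCTF, CSCV-W`, the three children a route-level
split of crux 16625 would file (the two tail inputs of the 9133 split are the clock's own antecedents). [cite: Yau1991, §2] -/
theorem transferEntropyClock_of_subs :
    OneFlightGossipEngine.KineticCurrentsLDAlongFamilies → LocalClampedTransferWindowLDFamily →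
      CoherentSuprathermalContentVanishesW → TwoClocks.TransferEntropyClock :=
  fun hK hL hC => stub_transferEntropyClockOfFamilyNodes (show KineticCurrentsWindowLDFamily from hK) hL hC

end Summit.AtomisticToContinuum.HydrodynamicLimit.Theorems.TransferEntropyClockHeart
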